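/-
Copyright (c) 2026 the pub-hodgecm-mathlib formalisation cell (harness21).  Prover seat hodgecm-mathlib-K2Liu-p09 (g5): Track B «K2-LIT»,
hLiu418 = stmt-HodgeConjecture-24832; LEAD F0P6-plan RULINGS M-156m∕o, M-157a (4)∕m «A7 = GK COCYCLE ROAD», file B7-N (ASK-N, self-typed).
-/
import Summits.HodgeConjecture.HodgeConjecture.Theorems.K2LiuRankOneOperators          -- ★ B3 `isQRationalRegularAt_normalised` (the `q = q_w` case)
import Summits.HodgeConjecture.HodgeConjecture.Theorems.K2LiuFlatSiegelFamilies        -- ★ B2 `natCast_zpow_cpow`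
import HarnessLib

/-!
# Crux `HLiu418`, road `K2_Liu`, organ A7-reg (GK cocycle road), file B7-N:
# THE NORMALISED RANK-ONE VALUE IS `q₀^{-s}`-RATIONAL AND REGULAR AT `½` FOR ANY BASE `q₀` WITH `q_w = q₀^d`

Cell `hodgecm-mathlib`, crux item hLiu418 = `stmt-HodgeConjecture-24832`; squad K2 ∕ K2Liu; prover K2Liu-p09 (g5).  THEOREMS ONLY; lane
`--supports stmt-HodgeConjecture-24832` (count-neutral helper).
THE POINT.  ★ B3 `K2LiuRankOneOperators.isQRationalRegularAt_normalised` measures `q^{-s}`-rationality at `q = q_w`, the residue cardinality of the field the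
rank-one operator integrates over.  The middle step of the cocycle integrates over `E_w` with `q_w = q_v^{f(w|v)}` while the face (A4′-R) wants rationality in
`q_v^{-s}`; a function rational in `q_v^{-s}` need not be rational in `q_w^{-s}`, so the hypotheses must be taken at base `q_v` from the start.  This file is that
variant: all `IsQRationalRegularAt` clauses at an arbitrary base `q₀ ≠ 0` with `q_w = q₀^d`; the only new point is the monomial
`q_w^{1 − e(s)} = q₀^{d(1−c)} · (q₀^{-s})^{da}` (★ B2 `natCast_zpow_cpow`, ★ (a) `qVar_natMul_add`).
HONEST LABEL.  `HC_CM` is proved only modulo the 7 printed citations (2 remaining named inputs: hLiu418 = `stmt-HodgeConjecture-24832`,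
h413 = `stmt-HodgeConjecture-24833`) until rung 0 closes.

## References
* [KudlaSweet1997] S. Kudla, W. J. Sweet, Israel J. Math. 98 (1997), §1 (rationality in `q^{-s}` of normalised local data).
* [Casselman1980] W. Casselman, *The unramified principal series of p-adic groups I*, Compositio Math. 40 (1980), §3.
* [NeukirchANT1999] J. Neukirch, *Algebraic Number Theory* (1999), Ch. II (6.2) (`q_w = q_v^f`).
-/

set_option autoImplicit false
set_option linter.dupNamespace false -- the mandated namespace repeats `HodgeConjecture.HodgeConjecture`

noncomputable section

open MeasureTheory
open scoped NNReal ENNReal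
open NumberField IsDedekindDomain
open Literature.NumberTheory.GaloisRepresentations.IsNonarchimedeanLocalField
open Literature.NumberTheory.Automorphic Literature.NumberTheory.Automorphic.LocalFieldHaar
open Summit.HodgeConjecture.HodgeConjecture.Cruxes.HLiu418.K2LiuQRationalDefs
open Summit.HodgeConjecture.HodgeConjecture.Cruxes.HLiu418.K2LiuQRationalLFactor
open Summit.HodgeConjecture.HodgeConjecture.Cruxes.HLiu418.K2LiuLocalLFactorDefs
open Summit.HodgeConjecture.HodgeConjecture.Cruxes.HLiu418.K2LiuFlatSiegelFamilies

namespace Summit.HodgeConjecture.HodgeConjecture.Cruxes.HLiu418.K2LiuRankOneFamiliesBase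

variable {K : Type} [Field K] [NumberField K] {w : HeightOneSpectrum (𝓞 K)} {G : Type*} [Group G]
  [MeasurableSpace (w.adicCompletion K)] (μ : Measure (w.adicCompletion K))

omit [MeasurableSpace (w.adicCompletion K)] in
/-- **the monomial `q_w^{1 − (a s + c)}` is a Laurent monomial in `q₀^{-s}`** when `q_w = q₀^d`: `= q₀^{-(d(c−1))} · (q₀^{-s})^{da}`.
[cite: NeukirchANT1999, Ch. II (6.2)] [cite: KudlaSweet1997, §1] -/
theorem isQRationalRegularAt_monomial_base (q₀ d : ℕ) (hq₀ : q₀ ≠ 0) (hq : residueFieldCard (w.adicCompletion K) = q₀ ^ d) (a : ℕ) (c s₀ : ℂ) :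
    IsQRationalRegularAt q₀ s₀ fun s => (residueFieldCard (w.adicCompletion K) : ℂ) ^ (1 - ((a : ℂ) * s + c)) := by
  refine ((isQRationalRegularAt_qVar_pow q₀ s₀ (d * a)).const_mul (qVar q₀ ((d : ℂ) * (c - 1)))).congr fun s => ?_
  show qVar q₀ ((d : ℂ) * (c - 1)) * qVar q₀ s ^ (d * a) = (residueFieldCard (w.adicCompletion K) : ℂ) ^ (1 - ((a : ℂ) * s + c))
  rw [hq, Nat.cast_pow, show ((q₀ : ℂ) ^ d) = (q₀ : ℂ) ^ (d : ℤ) from (zpow_natCast _ d).symm, natCast_zpow_cpow,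
    ← qVar_natMul_add hq₀ (d * a) ((d : ℂ) * (c - 1)) s, qVar_def]
  congr 1
  push_cast
  ring

/-- **THE NORMALISED VALUE IS `q₀^{-s}`-RATIONAL AND REGULAR AT `½`, base `q₀` with `q_w = q₀^d`** — ★ B3 `isQRationalRegularAt_normalised` verbatim with every
`IsQRationalRegularAt` clause at base `q₀`: with `e(s) = a·s + c`, a character `ν`, and `s ↦ C₀(s)`, `s ↦ f_s(y)`, `s ↦ f_s(w u(b) y)` (`b ∈ R`) regular at `½`
in `q₀^{-s}`, the function `s ↦ (1 − unramValue ν q_w^{−(e(s)−1)}) Σ_{b∈R} μ(𝔭^m) f_s(w u(b) y) + C₀(s) f_s(y) (1 − q_w⁻¹) μ(𝒪) (unramValue ν q_w^{1−e(s)})^{m+1}` is regular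
at `½` in `q₀^{-s}`. [cite: KudlaSweet1997, §1] [cite: Casselman1980, §3] -/
theorem isQRationalRegularAt_normalised_base (q₀ d : ℕ) (hq₀ : q₀ ≠ 0) (hq : residueFieldCard (w.adicCompletion K) = q₀ ^ d)
    (f : ℂ → G → ℂ) {u : w.adicCompletion K → G} (w₀ y : G)
    (ν : (w.adicCompletion K)ˣ →* ℂˣ) (a : ℕ) (c : ℂ) (C₀ : ℂ → ℂ) (m : ℕ) (R : Finset (w.adicCompletion K))
    (hC₀ : IsQRationalRegularAt q₀ (1 / 2) C₀)
    (hfy : IsQRationalRegularAt q₀ (1 / 2) fun s => f s y)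
    (hfR : ∀ b ∈ R, IsQRationalRegularAt q₀ (1 / 2) fun s => f s (w₀ * u b * y)) :
    IsQRationalRegularAt q₀ (1 / 2) fun s =>
      (1 - unramValue K w ν * (residueFieldCard (w.adicCompletion K) : ℂ) ^ (-(((a : ℂ) * s + c) - 1))) *
          (∑ b ∈ R, (μ.real (primePowBall (w.adicCompletion K) (m : ℤ)) : ℂ) * f s (w₀ * u b * y)) +
        C₀ s * f s y * (1 - (residueFieldCard (w.adicCompletion K) : ℂ)⁻¹) * μ.real (primePowBall (w.adicCompletion K) 0) *
          (unramValue K w ν * (residueFieldCard (w.adicCompletion K) : ℂ) ^ (1 - ((a : ℂ) * s + c))) ^ (m + 1) := by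
  set q : ℕ := residueFieldCard (w.adicCompletion K) with hqdef
  have hmono : IsQRationalRegularAt q₀ (1 / 2) fun s => (q : ℂ) ^ (1 - ((a : ℂ) * s + c)) :=
    isQRationalRegularAt_monomial_base q₀ d hq₀ hq a c (1 / 2)
  have hmono' : IsQRationalRegularAt q₀ (1 / 2) fun s => (q : ℂ) ^ (-(((a : ℂ) * s + c) - 1)) :=
    hmono.congr fun s => by show (q : ℂ) ^ (1 - ((a : ℂ) * s + c)) = _; congr 1; ring
  have hhead : IsQRationalRegularAt q₀ (1 / 2) fun s => ∑ b ∈ R, (μ.real (primePowBall (w.adicCompletion K) (m : ℤ)) : ℂ) * f s (w₀ * u b * y) :=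
    IsQRationalRegularAt.sum R fun b hb => (hfR b hb).const_mul _
  have h1 : IsQRationalRegularAt q₀ (1 / 2) fun s => 1 - unramValue K w ν * (q : ℂ) ^ (-(((a : ℂ) * s + c) - 1)) :=
    (isQRationalRegularAt_const q₀ _ 1).sub (hmono'.const_mul _)
  have h2 : IsQRationalRegularAt q₀ (1 / 2) fun s => (unramValue K w ν * (q : ℂ) ^ (1 - ((a : ℂ) * s + c))) ^ (m + 1) := by
    have h := hmono.const_mul (unramValue K w ν)
    exact IsQRationalRegularAt.prod (Finset.range (m + 1)) (Φ := fun _ s => unramValue K w ν * (q : ℂ) ^ (1 - ((a : ℂ) * s + c)))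
      (fun _ _ => h) |>.congr fun s => by simp [Finset.prod_const, Finset.card_range]
  exact (h1.mul hhead).add ((((hC₀.mul hfy).mul (isQRationalRegularAt_const q₀ _ _)).mul (isQRationalRegularAt_const q₀ _ _)).mul h2)

end Summit.HodgeConjecture.HodgeConjecture.Cruxes.HLiu418.K2LiuRankOneFamiliesBase

end
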